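import Mathlib
import Summits.CriticalPhenomena.CardyFormulaZ2.Theorems.CardyMagicRigidityNestingRigidityUVLinearisation
import Summits.CriticalPhenomena.CardyFormulaZ2.Theorems.CardyMagicRigidityNestingRigidityUVTiltTransferCollar
import HarnessLib

/-!
# Line `Sketch` (v6) for crux `MagicFormulaT`, stub S4b `stub_uvSandwich`: the pathwise sandwich of a
# band product by the exponentials of the additive band statistics (both lattices)

Crux `Summit.CriticalPhenomena.CardyFormulaZ2.Theses.CardyMagicRigidity.MagicFormulaT`
(stmt-CriticalPhenomena-4836), line `Sketch`, registered skeleton v6, stub S4b.  For an admissible density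
`f` (`|f| ≤ C`, `f = 0` off `B̄(0, R)`, `∫ f = 0`), a mesh `δ > 0`, a lattice ensemble
`E ∈ latticeEnsembles = {zEns, tEns}` and a band `[a, b)` of loop diameters with
`b ≤ r₀(C) = min 1 (1 / (2 √(3 · max C 1)))`, configuration by configuration:

* every loop `u` of the band has a small phase, `|θ_u| = |∫_{int u} f| ≤ C · π · diam(u)² ≤ π / 12`
  (`abs_nestingPhase_le_mul_volume_closedBall_diam`, `TiltTransfer.volume_real_closedBall`, `b ≤ r₀(C)`);
* a loop with `θ_u ≠ 0` meets `B̄(0, R)` (`nestingPhase_eq_zero_of_disjoint`) and, when its diameter is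
  `< b ≤ 1`, lies inside the open ball `B(0, |R| + 2)`; hence the band phase sum `Θ = Σ_{band} θ_u`, the
  band-restricted INNER statistics `Σ_{u ⊆ B(0, |R|+2)} 𝟙_{band}(u) θ_u`, `Σ_{u ⊆ B(0,|R|+2)} 𝟙_{band}(u) θ_u²`
  and the band product `∏_{band} w_u` (`w_u = 2cos(θ_u + π/3)`) are all honest finite sums / products over
  the finite family `S` of band loops meeting `B̄(0, R)` (`ConeTilt.finite_loops_meeting`);
* the finite sandwich `UVLinear.prod_nestingFactor_mem_Icc` at `a₀ = π/12 < π/6` then gives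
  `exp(−√3 Θ − Θ₂ / cos(π/12 + π/3)) ≤ ∏_{band} w_u ≤ exp(−√3 Θ)`.

Everything is proved from tree / Mathlib material; no named fact is used; no definition is introduced.
-/

noncomputable section

namespace Summit.CriticalPhenomena.CardyFormulaZ2.Cruxes.MagicFormulaT.LineSketch

open MeasureTheory Filter Set Metric
open scoped Real Topology BigOperators
open Literature.Probability.RandomPlanarGeometry Literature.Probability.Percolation
  Literature.Probability.LatticeModels
open Summit.CriticalPhenomena.CardyFormulaZ2.Cruxes.NestingRigidity.RingCloudTomography

/-! ## Loop-by-loop inputs -/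

/-- A loop with a non-zero phase against a neutral density carried by `B̄(0, R)` meets `B̄(0, R)`
(contrapositive of `nestingPhase_eq_zero_of_disjoint`). -/
theorem sw_meets_of_nestingPhase_ne_zero {f : ℂ → ℝ} {R : ℝ} (hR : ∀ z, R < ‖z‖ → f z = 0)
    (h0 : ∫ z, f z = 0) {u : UnbasedLoop ℂ} (hu : u.nestingPhase f ≠ 0) :
    (u.range ∩ closedBall (0 : ℂ) R).Nonempty := by
  by_contra h
  exact hu (nestingPhase_eq_zero_of_disjoint hR h0
    (Set.disjoint_iff_inter_eq_empty.2 (Set.not_nonempty_iff_eq_empty.1 h)))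

/-- A loop of diameter `< b ≤ 1` meeting `B̄(0, R)` lies inside the open ball `B(0, |R| + 2)`. -/
theorem sw_range_subset_ball {R b : ℝ} (hb1 : b ≤ 1) (u : UnbasedLoop ℂ) (hu : diam u.range < b)
    (hne : (u.range ∩ closedBall (0 : ℂ) R).Nonempty) : u.range ⊆ ball (0 : ℂ) (|R| + 2) := by
  obtain ⟨x, hxu, hxR⟩ := hne
  rw [mem_closedBall, dist_zero_right] at hxR
  intro y hy
  rw [mem_ball, dist_zero_right]
  have h1 : dist y x ≤ diam u.range := dist_le_diam_of_mem u.isCompact_range.isBounded hy hxu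
  calc ‖y‖ = ‖(y - x) + x‖ := by rw [sub_add_cancel]
    _ ≤ ‖y - x‖ + ‖x‖ := norm_add_le _ _
    _ = dist y x + ‖x‖ := by rw [dist_eq_norm]
    _ < |R| + 2 := by linarith [le_abs_self R]

/-- **Band loops have phases `≤ π/12`.**  For `|f| ≤ C` vanishing off `B̄(0, R)` and a loop of diameter
`< b ≤ 1 / (2 √(3 · max C 1))`: `|θ_u| ≤ C · π · diam² ≤ C · π · b² ≤ π C / (12 max C 1) ≤ π / 12`. -/
theorem sw_abs_nestingPhase_le {f : ℂ → ℝ} {R C : ℝ} (hC : ∀ z, |f z| ≤ C)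
    (hR : ∀ z, R < ‖z‖ → f z = 0) {b : ℝ} (hb : b ≤ min 1 (1 / (2 * Real.sqrt (3 * max C 1))))
    (u : UnbasedLoop ℂ) (hu : diam u.range < b) : |u.nestingPhase f| ≤ π / 12 := by
  obtain ⟨x, hx⟩ := u.range_nonempty
  have hC0 : 0 ≤ C := (abs_nonneg _).trans (hC 0)
  have hd0 : 0 ≤ diam u.range := diam_nonneg
  have hm : 0 < max C 1 := lt_max_of_lt_right one_pos
  have hCm : C ≤ max C 1 := le_max_left _ _
  have hs : 0 < Real.sqrt (3 * max C 1) := Real.sqrt_pos.2 (by positivity)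
  have hs2 : Real.sqrt (3 * max C 1) ^ 2 = 3 * max C 1 := Real.sq_sqrt (by positivity)
  have hb' : b ≤ 1 / (2 * Real.sqrt (3 * max C 1)) := hb.trans (min_le_right _ _)
  have hb0 : 0 ≤ b := hd0.trans hu.le
  have hb2 : b ^ 2 * (12 * max C 1) ≤ 1 := by
    have h1 : b * (2 * Real.sqrt (3 * max C 1)) ≤ 1 := by rwa [le_div_iff₀ (by positivity)] at hb'
    have h2 : 0 ≤ b * (2 * Real.sqrt (3 * max C 1)) := by positivity
    calc b ^ 2 * (12 * max C 1) = (b * (2 * Real.sqrt (3 * max C 1))) ^ 2 := by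
          rw [mul_pow, mul_pow, hs2]; ring
      _ ≤ 1 ^ 2 := pow_le_pow_left₀ h2 h1 2
      _ = 1 := one_pow 2
  calc |u.nestingPhase f| ≤ C * volume.real (closedBall x (diam u.range)) :=
        abs_nestingPhase_le_mul_volume_closedBall_diam hC hR u hx
    _ = C * (π * diam u.range ^ 2) := by rw [TiltTransfer.volume_real_closedBall x hd0]
    _ ≤ C * (π * b ^ 2) := mul_le_mul_of_nonneg_left
        (mul_le_mul_of_nonneg_left (pow_le_pow_left₀ hd0 hu.le 2) Real.pi_pos.le) hC0
    _ ≤ max C 1 * (π * b ^ 2) := mul_le_mul_of_nonneg_right hCm (by positivity)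
    _ = π / 12 * (b ^ 2 * (12 * max C 1)) := by ring
    _ ≤ π / 12 * 1 := mul_le_mul_of_nonneg_left hb2 (by positivity)
    _ = π / 12 := mul_one _

/-! ## Localisation to a finite family and the sandwich -/

/-- **The sandwich for an abstract loop family.**  If only finitely many loops of `L` meet `B̄(0, R)`, then
for an admissible `f` and a band `[a, b)` with `b ≤ r₀(C)`: the band phase sum over `L` is the inner
statistic over `B(0, |R| + 2)` of the band-restricted phase, and
`exp(−√3 Θ − Θ₂ / cos(π/12 + π/3)) ≤ ∏_{band} w_u ≤ exp(−√3 Θ)` (all four finitary operations are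
honest finite sums / products over the band loops meeting `B̄(0, R)`; then
`UVLinear.prod_nestingFactor_mem_Icc`). -/
theorem sw_sandwich_of_finite {f : ℂ → ℝ} {R C : ℝ} (hC : ∀ z, |f z| ≤ C)
    (hR : ∀ z, R < ‖z‖ → f z = 0) (h0 : ∫ z, f z = 0) {a b : ℝ}
    (hb : b ≤ min 1 (1 / (2 * Real.sqrt (3 * max C 1)))) (L : Set (UnbasedLoop ℂ))
    (hfin : {u ∈ L | (u.range ∩ closedBall (0 : ℂ) R).Nonempty}.Finite) :
    (∑ᶠ u ∈ {u ∈ L | a ≤ diam u.range ∧ diam u.range < b}, u.nestingPhase f) =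
        ∑ᶠ u ∈ {u ∈ L | u.range ⊆ ball (0 : ℂ) (|R| + 2)},
          (if a ≤ diam u.range ∧ diam u.range < b then u.nestingPhase f else 0) ∧
      Real.exp (-(Real.sqrt 3 *
            ∑ᶠ u ∈ {u ∈ L | u.range ⊆ ball (0 : ℂ) (|R| + 2)},
              (if a ≤ diam u.range ∧ diam u.range < b then u.nestingPhase f else 0)) -
          (∑ᶠ u ∈ {u ∈ L | u.range ⊆ ball (0 : ℂ) (|R| + 2)},
              (if a ≤ diam u.range ∧ diam u.range < b then u.nestingPhase f ^ 2 else 0)) /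
            Real.cos (π / 12 + π / 3)) ≤
        ∏ᶠ u ∈ {u ∈ L | a ≤ diam u.range ∧ diam u.range < b}, u.nestingFactor f ∧
      ∏ᶠ u ∈ {u ∈ L | a ≤ diam u.range ∧ diam u.range < b}, u.nestingFactor f ≤
        Real.exp (-(Real.sqrt 3 *
            ∑ᶠ u ∈ {u ∈ L | u.range ⊆ ball (0 : ℂ) (|R| + 2)},
              (if a ≤ diam u.range ∧ diam u.range < b then u.nestingPhase f else 0))) := by
  classical
  -- the finite family `S` of band loops meeting `B̄(0, R)`
  obtain ⟨S, hmemS⟩ : ∃ S : Finset (UnbasedLoop ℂ), ∀ u, u ∈ S ↔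
      (u ∈ L ∧ (u.range ∩ closedBall (0 : ℂ) R).Nonempty) ∧ (a ≤ diam u.range ∧ diam u.range < b) :=
    ⟨hfin.toFinset.filter fun u ↦ a ≤ diam u.range ∧ diam u.range < b, fun u ↦ by
      rw [Finset.mem_filter, Set.Finite.mem_toFinset, Set.mem_setOf_eq]⟩
  have hkey : ∀ u : UnbasedLoop ℂ, u.nestingPhase f ≠ 0 → (u.range ∩ closedBall (0 : ℂ) R).Nonempty :=
    fun u hu ↦ sw_meets_of_nestingPhase_ne_zero hR h0 hu
  have hb1 : b ≤ 1 := hb.trans (min_le_left _ _)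
  -- (1) the band phase sum
  have h1 : (∑ᶠ u ∈ {u ∈ L | a ≤ diam u.range ∧ diam u.range < b}, u.nestingPhase f) =
      ∑ u ∈ S, u.nestingPhase f := by
    have hiff : ∀ u ∈ Function.support (fun u : UnbasedLoop ℂ ↦ u.nestingPhase f),
        u ∈ {u ∈ L | a ≤ diam u.range ∧ diam u.range < b} ↔ u ∈ (↑S : Set (UnbasedLoop ℂ)) := by
      intro u hu
      rw [Finset.mem_coe, hmemS, Set.mem_setOf_eq]
      exact ⟨fun h ↦ ⟨⟨h.1, hkey u hu⟩, h.2⟩, fun h ↦ ⟨h.1.1, h.2⟩⟩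
    rw [finsum_mem_inter_support_eq' _ _ _ hiff, finsum_mem_coe_finset]
  -- (2) the inner statistic of the band-restricted phase
  have h2 : (∑ᶠ u ∈ {u ∈ L | u.range ⊆ ball (0 : ℂ) (|R| + 2)},
      (if a ≤ diam u.range ∧ diam u.range < b then u.nestingPhase f else 0)) =
      ∑ u ∈ S, u.nestingPhase f := by
    have hiff : ∀ u ∈ Function.support (fun u : UnbasedLoop ℂ ↦
        if a ≤ diam u.range ∧ diam u.range < b then u.nestingPhase f else 0),
        u ∈ {u ∈ L | u.range ⊆ ball (0 : ℂ) (|R| + 2)} ↔ u ∈ (↑S : Set (UnbasedLoop ℂ)) := by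
      intro u hu
      obtain ⟨hband, hθ⟩ := ite_ne_right_iff.1 hu
      rw [Finset.mem_coe, hmemS, Set.mem_setOf_eq]
      exact ⟨fun h ↦ ⟨⟨h.1, hkey u hθ⟩, hband⟩,
        fun h ↦ ⟨h.1.1, sw_range_subset_ball hb1 u hband.2 h.1.2⟩⟩
    rw [finsum_mem_inter_support_eq' _ _ _ hiff, finsum_mem_coe_finset]
    exact Finset.sum_congr rfl fun u hu ↦ if_pos ((hmemS u).1 hu).2
  -- (3) the inner statistic of the band-restricted squared phase
  have h3 : (∑ᶠ u ∈ {u ∈ L | u.range ⊆ ball (0 : ℂ) (|R| + 2)},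
      (if a ≤ diam u.range ∧ diam u.range < b then u.nestingPhase f ^ 2 else 0)) =
      ∑ u ∈ S, u.nestingPhase f ^ 2 := by
    have hiff : ∀ u ∈ Function.support (fun u : UnbasedLoop ℂ ↦
        if a ≤ diam u.range ∧ diam u.range < b then u.nestingPhase f ^ 2 else 0),
        u ∈ {u ∈ L | u.range ⊆ ball (0 : ℂ) (|R| + 2)} ↔ u ∈ (↑S : Set (UnbasedLoop ℂ)) := by
      intro u hu
      obtain ⟨hband, hθ2⟩ := ite_ne_right_iff.1 hu
      have hθ : u.nestingPhase f ≠ 0 := fun h ↦ hθ2 (by rw [h, sq, mul_zero])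
      rw [Finset.mem_coe, hmemS, Set.mem_setOf_eq]
      exact ⟨fun h ↦ ⟨⟨h.1, hkey u hθ⟩, hband⟩,
        fun h ↦ ⟨h.1.1, sw_range_subset_ball hb1 u hband.2 h.1.2⟩⟩
    rw [finsum_mem_inter_support_eq' _ _ _ hiff, finsum_mem_coe_finset]
    exact Finset.sum_congr rfl fun u hu ↦ if_pos ((hmemS u).1 hu).2
  -- (4) the band product
  have h4 : ∏ᶠ u ∈ {u ∈ L | a ≤ diam u.range ∧ diam u.range < b}, u.nestingFactor f =
      ∏ u ∈ S, u.nestingFactor f := by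
    have hiff : ∀ u ∈ Function.mulSupport (fun u : UnbasedLoop ℂ ↦ u.nestingFactor f),
        u ∈ {u ∈ L | a ≤ diam u.range ∧ diam u.range < b} ↔ u ∈ (↑S : Set (UnbasedLoop ℂ)) := by
      intro u hu
      have hθ : u.nestingPhase f ≠ 0 := fun h ↦
        hu (UnbasedLoop.nestingFactor_eq_one_of_nestingPhase_eq_zero h)
      rw [Finset.mem_coe, hmemS, Set.mem_setOf_eq]
      exact ⟨fun h ↦ ⟨⟨h.1, hkey u hθ⟩, h.2⟩, fun h ↦ ⟨h.1.1, h.2⟩⟩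
    rw [finprod_mem_inter_mulSupport_eq' _ _ _ hiff, finprod_mem_coe_finset]
  -- the finite sandwich at `a₀ = π / 12`
  have hθS : ∀ u ∈ S, |UnbasedLoop.nestingPhase f u| ≤ π / 12 := fun u hu ↦
    sw_abs_nestingPhase_le hC hR hb u ((hmemS u).1 hu).2.2
  have hπ : π / 12 < π / 6 := by linarith [Real.pi_pos]
  have key := UVLinear.prod_nestingFactor_mem_Icc S f hπ hθS
  rw [h1, h2, h3, h4]
  exact ⟨rfl, key⟩

/-! ## The registered stub -/

/-- **Stub S4b (`UVSandwich`, pathwise; both lattices).**  For `E ∈ latticeEnsembles`, an admissible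
density `f` (measurable, `|f| ≤ C`, `f = 0` off `B̄(0, R)`, `∫ f = 0`), a mesh `δ > 0` and a band `[a, b)`
of diameters with `b ≤ min 1 (1 / (2 √(3 max(C, 1))))`, for every configuration `ω`: the band phase sum
`Σ_{a ≤ diam u < b} θ_u` equals the inner statistic `Σ_{u ⊆ B(0, |R|+2)} 𝟙_{[a,b)}(diam u) θ_u`, and with
`Θ`, `Θ₂` the inner statistics of the band-restricted phase and squared phase,
`exp(−√3 Θ − Θ₂ / cos(π/12 + π/3)) ≤ ∏_{a ≤ diam u < b} 2cos(θ_u + π/3) ≤ exp(−√3 Θ)`.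
Band phases are `≤ π C diam² ≤ π/12` (`abs_nestingPhase_le_mul_volume_closedBall_diam`,
`Complex.volume_closedBall`); loops with a non-zero phase meet `B̄(0, R)`
(`nestingPhase_eq_zero_of_disjoint`) and, having diameter `< 1`, lie inside `B(0, |R| + 2)`; only
finitely many loops meet `B̄(0, R)` (`ConeTilt.finite_loops_meeting`); then
`UVLinear.prod_nestingFactor_mem_Icc`. -/
theorem stub_uvSandwich : ∀ E ∈ latticeEnsembles, ∀ (f : ℂ → ℝ) (R C : ℝ), Measurable f →
    (∀ z, |f z| ≤ C) → (∀ z, R < ‖z‖ → f z = 0) → ∫ z, f z = 0 →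
    ∀ (δ a b : ℝ), 0 < δ → 0 ≤ a → a ≤ b → b ≤ min 1 (1 / (2 * Real.sqrt (3 * max C 1))) → ∀ ω : E.Ω,
      (∑ᶠ u ∈ {u ∈ (E.X δ ω).loops | a ≤ Metric.diam u.range ∧ Metric.diam u.range < b},
          u.nestingPhase f) =
        ∑ᶠ u ∈ {u ∈ (E.X δ ω).loops | u.range ⊆ Metric.ball (0 : ℂ) (|R| + 2)},
          (if a ≤ Metric.diam u.range ∧ Metric.diam u.range < b then u.nestingPhase f else 0) ∧
      Real.exp (-(Real.sqrt 3 *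
            ∑ᶠ u ∈ {u ∈ (E.X δ ω).loops | u.range ⊆ Metric.ball (0 : ℂ) (|R| + 2)},
              (if a ≤ Metric.diam u.range ∧ Metric.diam u.range < b then u.nestingPhase f else 0)) -
          (∑ᶠ u ∈ {u ∈ (E.X δ ω).loops | u.range ⊆ Metric.ball (0 : ℂ) (|R| + 2)},
              (if a ≤ Metric.diam u.range ∧ Metric.diam u.range < b then u.nestingPhase f ^ 2 else 0)) /
            Real.cos (π / 12 + π / 3)) ≤
        ∏ᶠ u ∈ {u ∈ (E.X δ ω).loops | a ≤ Metric.diam u.range ∧ Metric.diam u.range < b},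
          u.nestingFactor f ∧
      ∏ᶠ u ∈ {u ∈ (E.X δ ω).loops | a ≤ Metric.diam u.range ∧ Metric.diam u.range < b},
          u.nestingFactor f ≤
        Real.exp (-(Real.sqrt 3 *
            ∑ᶠ u ∈ {u ∈ (E.X δ ω).loops | u.range ⊆ Metric.ball (0 : ℂ) (|R| + 2)},
              (if a ≤ Metric.diam u.range ∧ Metric.diam u.range < b then u.nestingPhase f else 0))) :=
  fun E hE _f _R _C _ hC hR h0 δ _a _b hδ _ _ hb ω ↦
    sw_sandwich_of_finite hC hR h0 hb (E.X δ ω).loops (ConeTilt.finite_loops_meeting E hE hδ ω _)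

end Summit.CriticalPhenomena.CardyFormulaZ2.Cruxes.MagicFormulaT.LineSketch

end
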